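import Summits.QuantumFields.BalabanUV.T4Continuum.Support.UnitaryCayley
import Literature.MathematicalPhysics.QuantumFieldTheory.Balaban1983to89.B7Prop2Explicit

/-!
# UnitaryCayleyPath — BRICK B2b of the requested lattice lemma `torusSmallFieldGlobalGauge` (INTERFACE REQUEST NE7, route #1 of the NE7
# crux, stub S7 NODE O): the HERMITIAN GENERATOR `H = gen k W = i(2(1 + c̄W)⁻¹ − 1)` of a unitary `W` off the resolvent point `−c`,
# `c = scay k`, with `W = c·cay(H)`, and the CAYLEY PATH `A_t(W) = cay(−(t∕M)k·1)·cay(−(t∕M)H)` from `1` to `W⁻¹` in `U(n)`: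
# unit-valued, `A_0 = 1`, `A_M = W⁻¹`, steps `≤ (2|k| + 2‖H‖)∕M`, Lipschitz in `W` through the resolvent, conjugation-equivariant

Cell `pub-balaban`, rung (B)+1 sub-cell t4, lineage `b2b-balaban-t4-ne7-p1`, generation 26 (CRUX PROVER NE7 #1, ruling e34b3e0c); crux
skeleton `t4/skeletons/NE7-CRUX-R1.md` v1.7.6 §4 «INTERFACE REQUEST NE7» (HOME/INBOX.md ll.6031–6037); bricks B1 = `TorusGaugeComb` (p259900),
B2a = `UnitaryCayley` (p260933), B3a = `TorusLineHolonomy`.  HONEST FRAMING (page 1): FIXED FINITE T⁴, rung (B)+1; NE7, NE3 NOT PRINTED in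
[Balaban1984PropagatorsI]–[Balaban1989LargeFieldII] and NOT PROVED here; continuum YM on T⁴ ⇐ BetaPertH ∧ nine spine estimates (0/9 proved);
BetaPertH ⇐ (D1) ∧ (D4) ∧ CAP+tail; G-an2-4 gates asym, D1 and NE2/3/4; NOT infinite volume, NOT mass gap, NOT Clay.

WHAT ([folklore] matrix analysis on `M_n(ℂ)` with the L²-operator norm; every identity is a resolvent identity):
 * §1 `unitOf`, **`cayU`** (the Cayley transform as a unit of `M_n(ℂ)`, `1` off Hermitian arguments): `cayU_val`, `cayU_mem`, `cayU_zero`,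
   `cayU_mul_cayU_neg`, `cayU_conj`, `cayU_smul_one_comm`.
 * §2 `resolv k W = W + scay k·1`, `twist k W = scay(−k)·W`, **`gen k W = i(2(1 + twist)⁻¹ − 1)`**: `one_add_twist`, `isUnit_det_one_add_twist`,
   `inv_one_add_twist`, `norm_inv_one_add_twist`, `star_inv_one_add` (`R⋆ = 1 − R` for unitary `Wt`), **`gen_isHermitian`**, **`cay_gen`**
   (`cay(gen k W) = twist k W`), **`val_eq_scay_smul_cay_gen`** (`W = scay k·cay(gen k W)`), `norm_gen_le`, **`norm_gen_sub_gen_le`**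
   (`‖gen k W − gen k W′‖ ≤ 2‖(resolv k W)⁻¹‖‖(resolv k W′)⁻¹‖‖W − W′‖`), `resolv_conj`, **`gen_conj`**.
 * §3 **`cpath M k t W`**: `cpath_zero`, **`cpath_top`** (`A_M = W⁻¹`), `cpath_mem`, **`cpath_speed`**, **`cpath_lip`**, **`cpath_conj`**.
HONEST: elementary; nothing of Bałaban asserted; nothing of NE3∕NE7 discharged; 0 sorry.
-/

set_option autoImplicit false

open scoped BigOperators Matrix Matrix.Norms.L2Operator ComplexConjugate
open NormedSpace Complex Matrix

namespace Summit.QuantumFields.BalabanUV.T4Continuum.UnitaryCayleyPath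

open Literature.MathematicalPhysics.QuantumFieldTheory.Balaban1983to89
open B7Prop2Explicit (unitaryUnits mem_unitaryUnits)
open UnitaryCayley

noncomputable section

variable {n : Type*} [Fintype n] [DecidableEq n]

/-! ## §1 The Cayley transform as a unit -/

/-- A unitary matrix as a unit of `M_n(ℂ)` (inverse = adjoint). [folklore] -/
def unitOf (X : Matrix n n ℂ) (hX : X ∈ Matrix.unitaryGroup n ℂ) : (Matrix n n ℂ)ˣ :=
  ⟨X, star X, Matrix.mem_unitaryGroup_iff.mp hX, Matrix.mem_unitaryGroup_iff'.mp hX⟩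

omit [Fintype n] [DecidableEq n] in
/-- Hermitian-ness is decidable classically (used by `cayU`). [folklore] -/
instance decIsHermitian (X : Matrix n n ℂ) : Decidable X.IsHermitian := Classical.dec _

/-- **THE CAYLEY UNIT** `cayU X`: the unit `cay X` (inverse `cay (−X) = (cay X)⋆`) for Hermitian `X`, and `1` otherwise. [folklore] -/
def cayU (X : Matrix n n ℂ) : (Matrix n n ℂ)ˣ :=
  if h : X.IsHermitian then unitOf (cay X) (cay_mem_unitaryGroup h) else 1

/-- The value of `cayU X` is `cay X` for Hermitian `X`. [folklore] -/
theorem cayU_val {X : Matrix n n ℂ} (hX : X.IsHermitian) : ((cayU X : (Matrix n n ℂ)ˣ) : Matrix n n ℂ) = cay X := by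
  simp [cayU, hX, unitOf]

/-- `cayU X` is a unitary unit. [folklore] -/
theorem cayU_mem (X : Matrix n n ℂ) : cayU X ∈ unitaryUnits (Matrix n n ℂ) := by
  by_cases hX : X.IsHermitian
  · rw [mem_unitaryUnits, cayU_val hX]; exact cay_mem_unitaryGroup hX
  · simp only [cayU, hX, dite_false]; exact (unitaryUnits _).one_mem

/-- `cayU 0 = 1`. [folklore] -/
theorem cayU_zero : cayU (0 : Matrix n n ℂ) = 1 := by
  apply Units.ext
  rw [cayU_val Matrix.isHermitian_zero, cay_zero, Units.val_one]

/-- `cayU X · cayU (−X) = 1`, i.e. `(cayU X)⁻¹ = cayU (−X)`. [folklore] -/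
theorem cayU_inv {X : Matrix n n ℂ} (hX : X.IsHermitian) : (cayU X)⁻¹ = cayU (-X) := by
  apply inv_eq_of_mul_eq_one_right
  apply Units.ext
  rw [Units.val_mul, cayU_val hX, cayU_val hX.neg, Units.val_one]
  exact cay_mul_cay_neg hX

/-- For a unitary unit `B`: `B⁻¹` has value `(↑B)⁻¹ = star ↑B`, and `↑B` has unit determinant. [folklore] -/
theorem unit_facts {B : (Matrix n n ℂ)ˣ} (hB : B ∈ unitaryUnits (Matrix n n ℂ)) :
    IsUnit (B : Matrix n n ℂ).det ∧ ((B⁻¹ : (Matrix n n ℂ)ˣ) : Matrix n n ℂ) = (B : Matrix n n ℂ)⁻¹ :=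
  ⟨(inv_eq_star_of_mem (mem_unitaryUnits.mp hB)).1, Matrix.coe_units_inv B⟩

/-- **Conjugation equivariance of the Cayley unit**: `cayU (B X B⁻¹) = B · cayU X · B⁻¹` for unitary `B` and Hermitian `X`. [folklore] -/
theorem cayU_conj {B : (Matrix n n ℂ)ˣ} (hB : B ∈ unitaryUnits (Matrix n n ℂ)) {X : Matrix n n ℂ} (hX : X.IsHermitian) :
    cayU ((B : Matrix n n ℂ) * X * (B : Matrix n n ℂ)⁻¹) = B * cayU X * B⁻¹ := by
  have hBm : (B : Matrix n n ℂ) ∈ Matrix.unitaryGroup n ℂ := mem_unitaryUnits.mp hB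
  apply Units.ext
  rw [cayU_val (isHermitian_conj hBm hX), Units.val_mul, Units.val_mul, cayU_val hX, (unit_facts hB).2]
  exact cay_conj hBm hX

/-- The scalar Cayley unit commutes with everything: `cayU (a·1) · Y = Y · cayU (a·1)`. [folklore] -/
theorem cayU_smul_one_comm (a : ℝ) (Y : (Matrix n n ℂ)ˣ) : cayU ((a : ℂ) • (1 : Matrix n n ℂ)) * Y = Y * cayU ((a : ℂ) • (1 : Matrix n n ℂ)) := by
  apply Units.ext
  rw [Units.val_mul, Units.val_mul, cayU_val (smul_one_isHermitian a), cay_smul_one, Matrix.smul_mul, Matrix.mul_smul, one_mul, mul_one]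

/-! ## §2 The resolvent, the twist and the Hermitian generator -/

/-- The RESOLVENT ELEMENT `W + scay k · 1` (invertible iff `−scay k ∉ σ(W)`). [folklore] -/
def resolv (k : ℝ) (W : (Matrix n n ℂ)ˣ) : Matrix n n ℂ := (W : Matrix n n ℂ) + scay k • (1 : Matrix n n ℂ)

/-- The TWISTED unitary `scay(−k) · W` (so that the resolvent point becomes `−1`). [folklore] -/
def twist (k : ℝ) (W : (Matrix n n ℂ)ˣ) : Matrix n n ℂ := scay (-k) • (W : Matrix n n ℂ)

/-- **THE HERMITIAN GENERATOR** `gen k W = i·(2(1 + twist k W)⁻¹ − 1)` (`= i(1 − W̃)(1 + W̃)⁻¹`, `W̃ = twist k W`). [folklore] -/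
def gen (k : ℝ) (W : (Matrix n n ℂ)ˣ) : Matrix n n ℂ := I • ((2 : ℂ) • (1 + twist k W)⁻¹ - 1)

/-- `scay k · scay (−k) = 1`. [folklore] -/
theorem scay_mul_scay_neg (k : ℝ) : scay k * scay (-k) = 1 := by rw [mul_comm]; exact scay_neg_mul_scay k

/-- `scay k ≠ 0`. [folklore] -/
theorem scay_ne_zero (k : ℝ) : scay k ≠ 0 := fun h => by simpa [h] using scay_mul_scay_neg k

/-- `conj (scay k) = scay (−k)`. [folklore] -/
theorem conj_scay (k : ℝ) : conj (scay k) = scay (-k) := by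
  unfold scay
  push_cast
  simp only [map_mul, map_inv₀, map_add, map_sub, map_one, Complex.conj_I, Complex.conj_ofReal]
  ring

/-- `1 + twist k W = scay(−k) · resolv k W`. [folklore] -/
theorem one_add_twist (k : ℝ) (W : (Matrix n n ℂ)ˣ) : 1 + twist k W = scay (-k) • resolv k W := by
  rw [resolv, twist, smul_add, smul_smul, scay_neg_mul_scay, one_smul, add_comm]

/-- If the resolvent is invertible, so is `1 + twist`. [folklore] -/
theorem isUnit_det_one_add_twist {k : ℝ} {W : (Matrix n n ℂ)ˣ} (h : IsUnit (resolv k W).det) : IsUnit (1 + twist k W).det := by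
  rw [one_add_twist, Matrix.det_smul]
  exact (IsUnit.pow _ (Ne.isUnit (scay_ne_zero (-k)))).mul h

/-- `(1 + twist k W)⁻¹ = scay k · (resolv k W)⁻¹`. [folklore] -/
theorem inv_one_add_twist {k : ℝ} {W : (Matrix n n ℂ)ˣ} (h : IsUnit (resolv k W).det) :
    (1 + twist k W)⁻¹ = scay k • (resolv k W)⁻¹ := by
  apply Matrix.inv_eq_left_inv
  rw [one_add_twist, smul_mul_smul_comm, scay_mul_scay_neg, one_smul, Matrix.nonsing_inv_mul _ h]

/-- `‖(1 + twist k W)⁻¹‖ = ‖(resolv k W)⁻¹‖`. [folklore] -/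
theorem norm_inv_one_add_twist {k : ℝ} {W : (Matrix n n ℂ)ˣ} (h : IsUnit (resolv k W).det) :
    ‖(1 + twist k W)⁻¹‖ = ‖(resolv k W)⁻¹‖ := by
  rw [inv_one_add_twist h, norm_smul, norm_scay, one_mul]

/-- The twist of a unitary is unitary. [folklore] -/
theorem twist_mem {k : ℝ} {W : (Matrix n n ℂ)ˣ} (hW : W ∈ unitaryUnits (Matrix n n ℂ)) : twist k W ∈ Matrix.unitaryGroup n ℂ := by
  have hWm : (W : Matrix n n ℂ) * star (W : Matrix n n ℂ) = 1 := Matrix.mem_unitaryGroup_iff.mp (mem_unitaryUnits.mp hW)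
  rw [Matrix.mem_unitaryGroup_iff, twist, star_smul, smul_mul_smul_comm, Complex.star_def, conj_scay, neg_neg,
    scay_neg_mul_scay, one_smul, hWm]

/-- For unitary `Wt` with `1 + Wt` invertible: `((1 + Wt)⁻¹)⋆ = 1 − (1 + Wt)⁻¹`. [folklore] -/
theorem star_inv_one_add {Wt : Matrix n n ℂ} (hWt : Wt ∈ Matrix.unitaryGroup n ℂ) (h : IsUnit (1 + Wt).det) :
    star ((1 + Wt)⁻¹) = 1 - (1 + Wt)⁻¹ := by
  have hWW : Wt * star Wt = 1 := Matrix.mem_unitaryGroup_iff.mp hWt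
  -- `R Wt⋆ = Wt⋆ − R` from `R (1 + Wt) = 1`
  have hR : (1 + Wt)⁻¹ * (1 + Wt) = 1 := Matrix.nonsing_inv_mul _ h
  have hRW : (1 + Wt)⁻¹ * star Wt = star Wt - (1 + Wt)⁻¹ := by
    have h1 : (1 + Wt)⁻¹ * (1 + Wt) * star Wt = star Wt := by rw [hR, one_mul]
    rw [mul_assoc, add_mul, one_mul, hWW, mul_add, mul_one] at h1
    exact eq_sub_of_add_eq h1
  rw [Matrix.star_eq_conjTranspose, Matrix.conjTranspose_nonsing_inv, conjTranspose_add, conjTranspose_one,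
    ← Matrix.star_eq_conjTranspose]
  apply Matrix.inv_eq_left_inv
  rw [sub_mul, one_mul, mul_add, mul_one, hRW]
  abel

/-- **The generator is Hermitian** (unitary `W`, invertible resolvent). [folklore] -/
theorem gen_isHermitian {k : ℝ} {W : (Matrix n n ℂ)ˣ} (hW : W ∈ unitaryUnits (Matrix n n ℂ)) (h : IsUnit (resolv k W).det) :
    (gen k W).IsHermitian := by
  have hs := star_inv_one_add (twist_mem (k := k) hW) (isUnit_det_one_add_twist h)
  unfold Matrix.IsHermitian gen
  rw [← Matrix.star_eq_conjTranspose, star_smul, star_sub, star_smul, star_one, hs, Complex.star_def, Complex.conj_I,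
    map_ofNat]
  module

/-- **`cay (gen k W) = twist k W`** (invertible resolvent): `1 + i·gen = 2(1 − R)`, `1 − i·gen = 2R`, `(1 − R)R⁻¹ = (1 + W̃) − 1`. [folklore] -/
theorem cay_gen {k : ℝ} {W : (Matrix n n ℂ)ˣ} (h : IsUnit (resolv k W).det) : cay (gen k W) = twist k W := by
  have h1 := isUnit_det_one_add_twist (k := k) (W := W) h
  set R := (1 + twist k W)⁻¹ with hR
  have hIgen : I • gen k W = 1 - (2 : ℂ) • R := by
    rw [gen, smul_smul, Complex.I_mul_I, neg_smul, one_smul, neg_sub]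
  have hplus : (1 : Matrix n n ℂ) + I • gen k W = (2 : ℂ) • (1 - R) := by rw [hIgen]; module
  have hminus : (1 : Matrix n n ℂ) - I • gen k W = (2 : ℂ) • R := by rw [hIgen]; module
  have hRinv : R⁻¹ = 1 + twist k W := by rw [hR]; exact Matrix.nonsing_inv_nonsing_inv _ h1
  have hRdet : IsUnit R.det := by rw [hR]; exact Matrix.isUnit_nonsing_inv_det _ h1
  have h2R : ((2 : ℂ) • R)⁻¹ = (2 : ℂ)⁻¹ • R⁻¹ := by
    apply Matrix.inv_eq_left_inv
    rw [smul_mul_smul_comm, Matrix.nonsing_inv_mul _ hRdet]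
    norm_num
  rw [cay, hplus, hminus, h2R, smul_mul_smul_comm, hRinv, sub_mul, one_mul, hR, Matrix.nonsing_inv_mul _ h1]
  norm_num

/-- **`W = scay k · cay (gen k W)`** (invertible resolvent). [folklore] -/
theorem val_eq_scay_smul_cay_gen {k : ℝ} {W : (Matrix n n ℂ)ˣ} (h : IsUnit (resolv k W).det) :
    (W : Matrix n n ℂ) = scay k • cay (gen k W) := by
  rw [cay_gen h, twist, smul_smul, scay_mul_scay_neg, one_smul]

/-- `‖gen k W‖ ≤ 2‖(resolv k W)⁻¹‖ + ‖1‖`. [folklore] -/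
theorem norm_gen_le {k : ℝ} {W : (Matrix n n ℂ)ˣ} (h : IsUnit (resolv k W).det) :
    ‖gen k W‖ ≤ 2 * ‖(resolv k W)⁻¹‖ + ‖(1 : Matrix n n ℂ)‖ := by
  rw [gen, norm_smul, Complex.norm_I, one_mul, ← norm_inv_one_add_twist h]
  refine (norm_sub_le _ _).trans ?_
  rw [norm_smul, show ‖(2 : ℂ)‖ = 2 by norm_num]

/-- **Lipschitz dependence of the generator through the resolvent**:
`‖gen k W − gen k W′‖ ≤ 2‖(resolv k W)⁻¹‖·‖(resolv k W′)⁻¹‖·‖W − W′‖`. [folklore] -/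
theorem norm_gen_sub_gen_le {k : ℝ} {W W' : (Matrix n n ℂ)ˣ} (h : IsUnit (resolv k W).det) (h' : IsUnit (resolv k W').det) :
    ‖gen k W - gen k W'‖ ≤ 2 * ‖(resolv k W)⁻¹‖ * ‖(resolv k W')⁻¹‖ * ‖(W : Matrix n n ℂ) - W'‖ := by
  have h1 := isUnit_det_one_add_twist (k := k) (W := W) h
  have h1' := isUnit_det_one_add_twist (k := k) (W := W') h'
  have e1 : gen k W - gen k W' = ((2 : ℂ) * I) • ((1 + twist k W)⁻¹ * (twist k W' - twist k W) * (1 + twist k W')⁻¹) := by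
    rw [gen, gen, ← smul_sub, sub_sub_sub_cancel_right, ← smul_sub, smul_smul, mul_comm I, inv_sub_inv_eq h1 h1',
      add_sub_add_left_eq_sub]
  have e2 : twist k W' - twist k W = scay (-k) • ((W' : Matrix n n ℂ) - W) := by rw [twist, twist, smul_sub]
  rw [e1, e2, Matrix.mul_smul, Matrix.smul_mul, smul_smul, norm_smul]
  have hc : ‖2 * I * scay (-k)‖ = 2 := by
    rw [norm_mul, norm_mul, Complex.norm_I, norm_scay, mul_one, mul_one]; norm_num
  rw [hc, ← norm_inv_one_add_twist h, ← norm_inv_one_add_twist h', norm_sub_rev (W : Matrix n n ℂ) W']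
  have hY : ‖(1 + twist k W)⁻¹ * ((W' : Matrix n n ℂ) - W) * (1 + twist k W')⁻¹‖
      ≤ ‖(1 + twist k W)⁻¹‖ * ‖(W' : Matrix n n ℂ) - W‖ * ‖(1 + twist k W')⁻¹‖ :=
    (norm_mul_le _ _).trans (mul_le_mul_of_nonneg_right (norm_mul_le _ _) (norm_nonneg _))
  calc 2 * ‖(1 + twist k W)⁻¹ * ((W' : Matrix n n ℂ) - W) * (1 + twist k W')⁻¹‖
      ≤ 2 * (‖(1 + twist k W)⁻¹‖ * ‖(W' : Matrix n n ℂ) - W‖ * ‖(1 + twist k W')⁻¹‖) := by gcongr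
    _ = _ := by ring

/-- The resolvent of a conjugate: `resolv k (B W B⁻¹) = B · resolv k W · B⁻¹`. [folklore] -/
theorem resolv_conj (k : ℝ) (W : (Matrix n n ℂ)ˣ) {B : (Matrix n n ℂ)ˣ} (hB : B ∈ unitaryUnits (Matrix n n ℂ)) :
    resolv k (B * W * B⁻¹) = (B : Matrix n n ℂ) * resolv k W * (B : Matrix n n ℂ)⁻¹ := by
  rw [resolv, resolv, Units.val_mul, Units.val_mul, (unit_facts hB).2, mul_add, add_mul, Matrix.mul_smul, Matrix.smul_mul, mul_one,
    Matrix.mul_nonsing_inv _ (unit_facts hB).1]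

/-- Invertibility and the norm of the inverse resolvent are conjugation invariant. [folklore] -/
theorem resolv_conj_inv (k : ℝ) {W B : (Matrix n n ℂ)ˣ} (hB : B ∈ unitaryUnits (Matrix n n ℂ)) (h : IsUnit (resolv k W).det) :
    IsUnit (resolv k (B * W * B⁻¹)).det ∧ ‖(resolv k (B * W * B⁻¹))⁻¹‖ = ‖(resolv k W)⁻¹‖ := by
  have hBm : (B : Matrix n n ℂ) ∈ Matrix.unitaryGroup n ℂ := mem_unitaryUnits.mp hB
  have hBd := (unit_facts hB).1
  rw [resolv_conj k W hB]
  refine ⟨?_, ?_⟩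
  · rw [Matrix.det_mul, Matrix.det_mul, mul_comm, ← mul_assoc, ← Matrix.det_mul, Matrix.nonsing_inv_mul _ hBd, Matrix.det_one, one_mul]
    exact h
  · rw [conj_inv hBd h, (inv_eq_star_of_mem hBm).2,
      CStarRing.norm_mul_mem_unitary _ (Unitary.star_mem hBm), CStarRing.norm_mem_unitary_mul _ hBm]

/-- **Conjugation equivariance of the generator**: `gen k (B W B⁻¹) = B · gen k W · B⁻¹`. [folklore] -/
theorem gen_conj (k : ℝ) {W B : (Matrix n n ℂ)ˣ} (hB : B ∈ unitaryUnits (Matrix n n ℂ)) (h : IsUnit (resolv k W).det) :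
    gen k (B * W * B⁻¹) = (B : Matrix n n ℂ) * gen k W * (B : Matrix n n ℂ)⁻¹ := by
  have hBd := (unit_facts hB).1
  have h1 := isUnit_det_one_add_twist (k := k) (W := W) h
  have e1 : 1 + twist k (B * W * B⁻¹) = (B : Matrix n n ℂ) * (1 + twist k W) * (B : Matrix n n ℂ)⁻¹ := by
    rw [twist, twist, Units.val_mul, Units.val_mul, (unit_facts hB).2, mul_add, add_mul, mul_one, Matrix.mul_nonsing_inv _ hBd,
      Matrix.mul_smul, Matrix.smul_mul]
  rw [gen, gen, e1, conj_inv hBd h1, Matrix.mul_smul, Matrix.smul_mul, mul_sub, sub_mul, mul_one, Matrix.mul_nonsing_inv _ hBd,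
    Matrix.mul_smul, Matrix.smul_mul]

/-! ## §3 The Cayley path -/

/-- **THE CAYLEY PATH** `A_t(W) = cay(−(t∕M)k·1) · cay(−(t∕M)·gen k W)`, a unit of `M_n(ℂ)` for every `t : ℕ`. [folklore] -/
def cpath (M : ℕ) (k : ℝ) (t : ℕ) (W : (Matrix n n ℂ)ˣ) : (Matrix n n ℂ)ˣ :=
  cayU (((-((t : ℝ) / M) * k : ℝ) : ℂ) • (1 : Matrix n n ℂ)) * cayU (((-((t : ℝ) / M) : ℝ) : ℂ) • gen k W)

variable {M : ℕ} {k : ℝ}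

/-- `A_0 = 1`. [folklore] -/
theorem cpath_zero (W : (Matrix n n ℂ)ˣ) : cpath M k 0 W = 1 := by
  simp only [cpath, Nat.cast_zero, zero_div, neg_zero, zero_mul, Complex.ofReal_zero, zero_smul, cayU_zero, mul_one]

/-- The values of the path are unitary. [folklore] -/
theorem cpath_mem (t : ℕ) (W : (Matrix n n ℂ)ˣ) : cpath M k t W ∈ unitaryUnits (Matrix n n ℂ) :=
  (unitaryUnits _).mul_mem (cayU_mem _) (cayU_mem _)

/-- **`A_M(W) = W⁻¹`** (unitary `W`, invertible resolvent, `M ≥ 1`). [folklore] -/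
theorem cpath_top (hM : 1 ≤ M) {W : (Matrix n n ℂ)ˣ} (hW : W ∈ unitaryUnits (Matrix n n ℂ)) (h : IsUnit (resolv k W).det) :
    cpath M k M W = W⁻¹ := by
  have hM0 : (M : ℝ) ≠ 0 := by exact_mod_cast (by omega : M ≠ 0)
  have hH := gen_isHermitian hW h
  have e1 : ((-((M : ℝ) / M) * k : ℝ) : ℂ) • (1 : Matrix n n ℂ) = -(((k : ℝ) : ℂ) • (1 : Matrix n n ℂ)) := by
    rw [div_self hM0, ← neg_smul]; push_cast; ring_nf
  have e2 : ((-((M : ℝ) / M) : ℝ) : ℂ) • gen k W = -gen k W := by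
    rw [div_self hM0]; push_cast; rw [neg_one_smul]
  -- `W = cayU gen · cayU (k·1)` as units
  have hWu : W = cayU (gen k W) * cayU (((k : ℝ) : ℂ) • (1 : Matrix n n ℂ)) := by
    apply Units.ext
    rw [Units.val_mul, cayU_val hH, cayU_val (smul_one_isHermitian k), cay_smul_one, Matrix.mul_smul, mul_one]
    exact val_eq_scay_smul_cay_gen h
  have hinv : W⁻¹ = (cayU (((k : ℝ) : ℂ) • (1 : Matrix n n ℂ)))⁻¹ * (cayU (gen k W))⁻¹ := by
    rw [← _root_.mul_inv_rev, ← hWu]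
  rw [cpath, e1, e2, ← cayU_inv (smul_one_isHermitian k), ← cayU_inv hH, hinv]

/-- `‖cayU X − cayU Y‖ ≤ 2‖X − Y‖` for Hermitian `X, Y` (values). [folklore] -/
theorem norm_cayU_sub_le {X Y : Matrix n n ℂ} (hX : X.IsHermitian) (hY : Y.IsHermitian) :
    ‖((cayU X : (Matrix n n ℂ)ˣ) : Matrix n n ℂ) - cayU Y‖ ≤ 2 * ‖X - Y‖ := by
  rw [cayU_val hX, cayU_val hY]; exact norm_cay_sub_cay_le hX hY

/-- A unitary unit has norm at most `1` (also for the empty index type). [folklore] -/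
theorem norm_coe_le_one {a : (Matrix n n ℂ)ˣ} (ha : a ∈ unitaryUnits (Matrix n n ℂ)) : ‖(a : Matrix n n ℂ)‖ ≤ 1 := by
  rcases isEmpty_or_nonempty n with hn | hn
  · rw [show (a : Matrix n n ℂ) = 0 from Subsingleton.elim _ _, norm_zero]; exact zero_le_one
  · exact (CStarRing.norm_of_mem_unitary (mem_unitaryUnits.mp ha)).le

/-- `‖a b − a′ b′‖ ≤ ‖a − a′‖ + ‖b − b′‖` for unitary units. [folklore] -/
theorem norm_mul_sub_mul_le {a a' b b' : (Matrix n n ℂ)ˣ} (ha' : a' ∈ unitaryUnits (Matrix n n ℂ)) (hb : b ∈ unitaryUnits (Matrix n n ℂ)) :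
    ‖((a * b : (Matrix n n ℂ)ˣ) : Matrix n n ℂ) - ((a' * b' : (Matrix n n ℂ)ˣ) : Matrix n n ℂ)‖
      ≤ ‖(a : Matrix n n ℂ) - a'‖ + ‖(b : Matrix n n ℂ) - b'‖ := by
  have ha1 : ‖(a' : Matrix n n ℂ)‖ ≤ 1 := norm_coe_le_one ha'
  have hb1 : ‖(b : Matrix n n ℂ)‖ ≤ 1 := norm_coe_le_one hb
  have e1 : ((a * b : (Matrix n n ℂ)ˣ) : Matrix n n ℂ) - ((a' * b' : (Matrix n n ℂ)ˣ) : Matrix n n ℂ)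
      = ((a : Matrix n n ℂ) - a') * (b : Matrix n n ℂ) + (a' : Matrix n n ℂ) * ((b : Matrix n n ℂ) - b') := by
    rw [Units.val_mul, Units.val_mul]; noncomm_ring
  rw [e1]
  calc _ ≤ ‖((a : Matrix n n ℂ) - a') * (b : Matrix n n ℂ)‖ + ‖(a' : Matrix n n ℂ) * ((b : Matrix n n ℂ) - b')‖ := norm_add_le _ _
    _ ≤ ‖(a : Matrix n n ℂ) - a'‖ * ‖(b : Matrix n n ℂ)‖ + ‖(a' : Matrix n n ℂ)‖ * ‖(b : Matrix n n ℂ) - b'‖ := by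
        gcongr <;> exact norm_mul_le _ _
    _ ≤ ‖(a : Matrix n n ℂ) - a'‖ * 1 + 1 * ‖(b : Matrix n n ℂ) - b'‖ := by gcongr
    _ = _ := by ring

/-- The two-factor estimate: `‖cayU(s·1)cayU(r·H) − cayU(s′·1)cayU(r′·H′)‖ ≤ 2‖s·1 − s′·1‖ + 2‖r·H − r′·H′‖` (Hermitian `H, H′`). [folklore] -/
theorem norm_pair_sub_le (s s' r r' : ℝ) {H H' : Matrix n n ℂ} (hH : H.IsHermitian) (hH' : H'.IsHermitian) :
    ‖((cayU (((s : ℝ) : ℂ) • (1 : Matrix n n ℂ)) * cayU (((r : ℝ) : ℂ) • H) : (Matrix n n ℂ)ˣ) : Matrix n n ℂ)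
        - ((cayU (((s' : ℝ) : ℂ) • (1 : Matrix n n ℂ)) * cayU (((r' : ℝ) : ℂ) • H') : (Matrix n n ℂ)ˣ) : Matrix n n ℂ)‖
      ≤ 2 * ‖((s : ℝ) : ℂ) • (1 : Matrix n n ℂ) - ((s' : ℝ) : ℂ) • (1 : Matrix n n ℂ)‖ + 2 * ‖((r : ℝ) : ℂ) • H - ((r' : ℝ) : ℂ) • H'‖ :=
  (norm_mul_sub_mul_le (cayU_mem _) (cayU_mem _)).trans
    (add_le_add (norm_cayU_sub_le (smul_one_isHermitian s) (smul_one_isHermitian s'))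
      (norm_cayU_sub_le (smul_isHermitian r hH) (smul_isHermitian r' hH')))

/-- **THE SPEED OF THE PATH**: `‖A_{t+1}(W) − A_t(W)‖ ≤ (2|k|·‖1‖ + 2‖gen k W‖)∕M` (unitary `W`, invertible resolvent, `M ≥ 1`). [folklore] -/
theorem cpath_speed (hM : 1 ≤ M) {W : (Matrix n n ℂ)ˣ} (hW : W ∈ unitaryUnits (Matrix n n ℂ)) (h : IsUnit (resolv k W).det) (t : ℕ) :
    ‖((cpath M k (t + 1) W : (Matrix n n ℂ)ˣ) : Matrix n n ℂ) - cpath M k t W‖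
      ≤ (2 * |k| * ‖(1 : Matrix n n ℂ)‖ + 2 * ‖gen k W‖) / M := by
  have hM0 : (0 : ℝ) < M := by exact_mod_cast hM
  have hH := gen_isHermitian hW h
  refine (norm_pair_sub_le _ _ _ _ hH hH).trans (le_of_eq ?_)
  rw [← sub_smul, ← sub_smul, ← Complex.ofReal_sub, ← Complex.ofReal_sub, norm_smul, norm_smul, Complex.norm_real, Complex.norm_real,
    Real.norm_eq_abs, Real.norm_eq_abs]
  have e1 : (-(((t + 1 : ℕ) : ℝ) / M) * k) - (-((t : ℝ) / M) * k) = -(k / M) := by push_cast; ring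
  have e2 : (-(((t + 1 : ℕ) : ℝ) / M)) - (-((t : ℝ) / M)) = -(1 / M) := by push_cast; ring
  rw [e1, e2, abs_neg, abs_neg, abs_div, abs_div, abs_one, abs_of_pos hM0]
  field_simp

/-- **LIPSCHITZ DEPENDENCE OF THE PATH ON THE HOLONOMY** (`t ≤ M`): `‖A_t(W) − A_t(W′)‖ ≤ 2‖gen k W − gen k W′‖`. [folklore] -/
theorem cpath_lip (hM : 1 ≤ M) {W W' : (Matrix n n ℂ)ˣ} (hW : W ∈ unitaryUnits (Matrix n n ℂ)) (h : IsUnit (resolv k W).det)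
    (hW' : W' ∈ unitaryUnits (Matrix n n ℂ)) (h' : IsUnit (resolv k W').det) {t : ℕ} (ht : t ≤ M) :
    ‖((cpath M k t W : (Matrix n n ℂ)ˣ) : Matrix n n ℂ) - cpath M k t W'‖ ≤ 2 * ‖gen k W - gen k W'‖ := by
  have hM0 : (0 : ℝ) < M := by exact_mod_cast hM
  have htM : (t : ℝ) / M ≤ 1 := by rw [div_le_one hM0]; exact_mod_cast ht
  have ht0 : 0 ≤ (t : ℝ) / M := by positivity
  refine (norm_pair_sub_le _ _ _ _ (gen_isHermitian hW h) (gen_isHermitian hW' h')).trans ?_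
  rw [sub_self, norm_zero, mul_zero, zero_add, ← smul_sub, norm_smul, Complex.norm_real, Real.norm_eq_abs, abs_neg, abs_of_nonneg ht0]
  calc 2 * ((t : ℝ) / M * ‖gen k W - gen k W'‖) ≤ 2 * (1 * ‖gen k W - gen k W'‖) := by gcongr
    _ = _ := by rw [one_mul]

/-- **CONJUGATION EQUIVARIANCE OF THE PATH**: `A_t(B W B⁻¹) = B · A_t(W) · B⁻¹` for unitary `B` (invertible resolvent). [folklore] -/
theorem cpath_conj {W B : (Matrix n n ℂ)ˣ} (hW : W ∈ unitaryUnits (Matrix n n ℂ)) (hB : B ∈ unitaryUnits (Matrix n n ℂ))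
    (h : IsUnit (resolv k W).det) (t : ℕ) : cpath M k t (B * W * B⁻¹) = B * cpath M k t W * B⁻¹ := by
  have hH := gen_isHermitian hW h
  have hs : ((((-((t : ℝ) / M) : ℝ)) : ℂ) • gen k (B * W * B⁻¹))
      = (B : Matrix n n ℂ) * (((((-((t : ℝ) / M) : ℝ)) : ℂ) • gen k W)) * (B : Matrix n n ℂ)⁻¹ := by
    rw [gen_conj k hB h, Matrix.mul_smul, Matrix.smul_mul]
  rw [cpath, cpath, hs, cayU_conj hB (smul_isHermitian _ hH), ← mul_assoc, ← mul_assoc, cayU_smul_one_comm _ B, mul_assoc B]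

end

end Summit.QuantumFields.BalabanUV.T4Continuum.UnitaryCayleyPath
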